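import Mathlib.Analysis.SpecialFunctions.Gamma.Basic
import Mathlib.Analysis.SpecialFunctions.ImproperIntegrals
import Mathlib.MeasureTheory.Integral.IntegralEqImproper
import HarnessLib

/-!
# Albritton–Brué–Colombo 2022, §4.2.4–4.2.6: the exponentially weighted convolution integrals of
  the fixed-point estimates

Analysis/FluidPDE proofs-layer file (theorems only): the two one-dimensional integrals that
carry the weighted-in-time estimates (4.27)–(4.37) of Albritton–Brué–Colombo 2022 (Ann. of Math.
196 = arXiv:2112.03116 [ABC], proof of Prop. 4.7), a rung of the proof line of the named fact
`Literature.Analysis.FluidPDE.albritton_brue_colombo` between the abstract contraction claim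
(`NSLerayHopfABCContraction.lean`) and the semigroup bounds of Lemma 4.4 (not formalised):

* (4.29)–(4.30) / (4.36): `∫_{−∞}^τ e^{(τ−s)b} e^{αs} (τ−s)^{−θ} ds = e^{ατ} Γ(1−θ) (α−b)^{θ−1}`
  for `α > b`, `θ < 1` (there `b = a + δ`, `α = 2(a+ε₀)` or `2a + ε₀`, `θ = 3/4` from the
  smoothing `H^{N−1} → H^{N+1/2}` of Lemma 4.4, and "using that `a + 2ε₀ − δ > 0`") —
  `integral_Iic_exp_mul_exp_mul_rpow`;
* (4.32): `∫_{−∞}^τ e^{(τ−s)b} e^{αs} ds = e^{ατ}/(α − b)` for `α > b` (there `α = 2a`,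
  `b = a + δ`, "provided `δ < a`") — `integral_Iic_exp_mul_exp`.

Both by the substitution `s = τ − r` (translation invariance and reflection of Lebesgue measure)
and Mathlib's `Real.integral_rpow_mul_exp_neg_mul_Ioi` (Euler's integral) /
`integral_exp_mul_Iic`. Nothing here is specific to Navier–Stokes.

## References

* D. Albritton, E. Brué, M. Colombo, Ann. of Math. 196 (2022) = arXiv:2112.03116, §4.2.4–4.2.6,
  (4.27)–(4.37). [AlbrittonBrueColombo2022]
-/

noncomputable section

open MeasureTheory Set Real

namespace Literature.Analysis.FluidPDE

namespace AlbrittonBrueColombo2022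

/-- **The substitution `s = τ − r` on a half line**: `∫_{(−∞,τ]} g(s) ds = ∫_{(0,∞)} g(τ − r) dr`
(translation invariance and reflection of Lebesgue measure). [folklore] -/
theorem integral_Iic_eq_integral_Ioi_sub {G : Type*} [NormedAddCommGroup G] [NormedSpace ℝ G]
    (g : ℝ → G) (τ : ℝ) : ∫ s in Iic τ, g s = ∫ r in Ioi 0, g (τ - r) := by
  -- translate: `s = x + τ`
  have h1 : ∫ x in Iic 0, g (x + τ) = ∫ s in Iic τ, g s := by
    have hmp : MeasurePreserving (fun x : ℝ => x + τ) volume volume := measurePreserving_add_right _ τ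
    have hemb : MeasurableEmbedding (fun x : ℝ => x + τ) :=
      (Homeomorph.addRight τ).measurableEmbedding
    have h := hmp.setIntegral_preimage_emb hemb g (Iic τ)
    have hpre : (fun x : ℝ => x + τ) ⁻¹' Iic τ = Iic 0 := by
      ext x; simp
    rwa [hpre] at h
  -- reflect: `x = -r`
  have h2 : ∫ r in Ioi 0, g (τ - r) = ∫ x in Iic 0, g (x + τ) := by
    have h := integral_comp_neg_Ioi 0 (fun x => g (x + τ))
    simp only [neg_zero] at h
    rw [← h]
    refine setIntegral_congr_fun measurableSet_Ioi fun r _ => ?_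
    simp only [sub_eq_neg_add]
  rw [h2, h1]

/-- **[ABC] (4.32)**: for `b < α`, `∫_{−∞}^τ e^{(τ−s)b} e^{αs} ds = e^{ατ}/(α − b)` ("provided
`δ < a`", with `α = 2a`, `b = a + δ`). [cite: AlbrittonBrueColombo2022, (4.32)] -/
theorem integral_Iic_exp_mul_exp {b α : ℝ} (h : b < α) (τ : ℝ) :
    ∫ s in Iic τ, exp ((τ - s) * b) * exp (α * s) = exp (α * τ) / (α - b) := by
  have hab : 0 < α - b := sub_pos.2 h
  have h1 : ∀ s, exp ((τ - s) * b) * exp (α * s) = exp (τ * b) * exp ((α - b) * s) := by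
    intro s
    rw [← exp_add, ← exp_add]
    ring_nf
  simp_rw [h1]
  rw [integral_const_mul, integral_exp_mul_Iic hab, ← mul_div_assoc, ← exp_add]
  ring_nf

/-- **[ABC] (4.29)–(4.30), (4.36): the weighted fractional convolution integral**: for `b < α`
and `θ < 1`,
`∫_{−∞}^τ e^{(τ−s)b} e^{αs} (τ−s)^{−θ} ds = e^{ατ} · (1/(α−b))^{1−θ} Γ(1−θ)`
(substitute `s = τ − r` and use Euler's integral `∫₀^∞ r^{−θ} e^{−(α−b)r} dr =
(α−b)^{θ−1} Γ(1−θ)`; in [ABC] `θ = 3/4`, `b = a + δ`, `α = 2(a + ε₀)` "using that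
`a + 2ε₀ − δ > 0`", resp. `α = 2a + ε₀`). [cite: AlbrittonBrueColombo2022, (4.29)–(4.30)] -/
theorem integral_Iic_exp_mul_exp_mul_rpow {b α θ : ℝ} (h : b < α) (hθ : θ < 1) (τ : ℝ) :
    ∫ s in Iic τ, exp ((τ - s) * b) * exp (α * s) * (τ - s) ^ (-θ) =
      exp (α * τ) * ((1 / (α - b)) ^ (1 - θ) * Gamma (1 - θ)) := by
  have hab : 0 < α - b := sub_pos.2 h
  have h1θ : 0 < 1 - θ := sub_pos.2 hθ
  rw [integral_Iic_eq_integral_Ioi_sub]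
  have h1 : ∀ r, exp ((τ - (τ - r)) * b) * exp (α * (τ - r)) * (τ - (τ - r)) ^ (-θ) =
      exp (α * τ) * (r ^ ((1 - θ) - 1) * exp (-((α - b) * r))) := by
    intro r
    rw [sub_sub_cancel, show (1 - θ) - 1 = -θ by ring, mul_comm (r ^ (-θ)), ← mul_assoc,
      ← exp_add, ← exp_add]
    ring_nf
  simp_rw [h1]
  rw [integral_const_mul, integral_rpow_mul_exp_neg_mul_Ioi h1θ hab]

/-- The same integral as an upper bound with the constant made explicit — the form used in
(4.30): `∫_{−∞}^τ e^{(τ−s)b} e^{αs} (τ−s)^{−θ} ds ≤ C(α−b, θ) e^{ατ}` with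
`C = (α−b)^{θ−1} Γ(1−θ)`. [cite: AlbrittonBrueColombo2022, (4.30)] -/
theorem integral_Iic_exp_mul_exp_mul_rpow_le {b α θ : ℝ} (h : b < α) (hθ : θ < 1) (τ : ℝ) :
    ∫ s in Iic τ, exp ((τ - s) * b) * exp (α * s) * (τ - s) ^ (-θ) ≤
      ((1 / (α - b)) ^ (1 - θ) * Gamma (1 - θ)) * exp (α * τ) := by
  rw [integral_Iic_exp_mul_exp_mul_rpow h hθ τ, mul_comm]

end AlbrittonBrueColombo2022

end Literature.Analysis.FluidPDE

end
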